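import Summits.ABC.IUTFork.Thm311RealInd1StripPacketDualBoxSharp
import Literature.IUT.LogVolume.PacketPolydiscVolumeGap
import HarnessLib

/-!
# [IUTchIII] Thm 3.11 (i) (Ind1)+(Ind2), genuine packet of TAME factors of ARBITRARY residue degrees: the FAILURE side of the room dichotomy
# QUANTIFIED — bits only on `S` + room failing ⟹ the `(R_I)^∼`-hull of every factorwise-strip orbit of the Θ-region `ι_{i₀}(g)·(R_I)^∼` has
# `log μ̄` at least `(Σ_j f(L_j)/D)·log p` BELOW the Dupuy–Hilado container's `−(A + Σ_i 1/e_i)·log p` (UNCONDITIONAL)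

PROOF-ONLY file (abc-iut cell, Cor. 3.12 sub-crew, seat abc-iut-c312-1 = holder of record of the typed [IUTchIII] Thm. 3.11, gen 21; offer (π′)
«C:VOLUME-FORM CONVERSE», file 2 of 2; sequel of gen 20's `Thm311RealInd1StripPacketDualBoxSharp` (row R28) over the classical Literature file
`PacketPolydiscVolumeGap`).  TAKES NO SIDE on [IUTchIII] Cor. 3.12.  No definition, no `Prop` fact, NO `JannsenWingbergMappingClass`: everything
UNCONDITIONAL (failing bits = displayed `hfix` binders off `S`).

SETTING = R28 (λ2) §3 VERBATIM.  Genuine packet `X = ⊗_{i∈I} K_{w_i}`, EVERY factor TAME (`p > 2`, `e_i ≤ p − 2`) of ANY residue degree; slot `i₀`,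
`‖g‖ = p^{−v/E}`, `A = (v−1) div E + 1 − |I|`; `S ⊆ I` carries NO bit hypothesis (a bit may hold there, or `f_i > 1`); off `S`: residue degree one,
`e_i ≥ 2`, and NO realised strip automorphism moves `ℤ_p·p` modulo `p·log_p(𝒪^×)` (`hfix`); R25 (A) §2's room inequality FAILS (verbatim, negated);
`H ≤ Aut_{ℚ_p}(X)` acts factorwise through the realised strip groups.  Write `ψ = dEquiv : X ≃ Π_j L_j` (Wedderburn factors `L_j`, `e_j = e(L_j)`,
`f_j = f(L_j)`, `D = Σ_j e_j f_j = dim_{ℚ_p} X`), `log μ̄ = packetLogμ` (Dupuy–Hilado §3.4).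

* §1 **`packetLogμ_packetHull_orbit_le_container_sub_of_not_room_mixed`** — the `(R_I)^∼`-hull of the `H`-orbit of `ι_{i₀}(g)·(R_I)^∼` is
  ADMISSIBLE and **`log μ̄(hull(H-orbit)) ≤ log μ̄(packetHull(p^{A}·log_p(R_I^×))) − (Σ_j f(L_j)/D)·log p`**, the container value being
  `log μ̄(packetHull(p^{A}·log_p(R_I^×))) = −(A + Σ_i 1/e_i)·log p`: R28 (λ2) §2 confines the hull to the polydisc of radius `R′_S`
  (`packetHull_orbit_smul_normalizedPacket_subset_polydisc_of_fixesBaseLine_off_mixed`), gen 19's `prodRadius_lt_container_of_not_room` gives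
  `R′_S < ‖p^{A}‖·∏_i p^{−1/e_i}` under the failing room inequality, and the classical polydisc volume gap
  (`packetLogμ_packetHull_le_container_sub_of_subset_preimage_polydisc_of_lt_of_tame`: a region confined strictly below the container's attained
  radius lies in the ONE-𝔪-STEP translate below the container translate `(p^{A}·⊗_i c_i^out)·(R_I)^∼`) converts the confinement into the
  log-volume gap — at EVERY factor count, EVERY residue `r` and EVERY mix of residue degrees.  R28 (λ2) §3's set statement `hull ≠ container` is
  the shadow `log μ̄(hull) < log μ̄(container)` (§1 `…_lt_container_…`).
* §2 **`packetLogμ_packetHull_orbit_le_container_sub_log_div_degree_of_not_room_mixed`** — the packet-intrinsic form of the margin: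
  `log μ̄(hull(H-orbit)) ≤ log μ̄(container hull) − (log p)/D`, `D = packetDegree` (every `f_j ≥ 1`).
READING (numbers about OUR typed objects; neutral): with R25 (A) §2 (bits on `S` + room ⟹ the junction identity `hull = packetHull(p^{A}·log_p(R_I^×))`,
mod hMC) and R28 (λ3) (the dichotomy as ONE displayed equivalence), the failure branch now carries a NUMBER: whenever the room inequality fails for
`S ⊇ {f_i ≠ 1} ∪ {bit_i}`, the per-summand log-volume which reading (P) of [IUTchIII] Cor. 3.12 integrates — `log μ̄` of the hull of the orbit of the
Θ-region under any factorwise-strip `H` (e.g. the group generated by print's single-factor (Ind1) strip moves, R28 (λ3) non-vacuity) — is at least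
`(Σ_j f(L_j)/D)·log p ≥ (log p)/D` below the Dupuy–Hilado container's value `−(A + Σ_i 1/e_i)·log p`.  Which value a bit takes is NOT claimed; the
`ln ν̄_{𝕃_p}`-level port (strict drop of the (P)-reading over `H` below `−|log(Θ)|^{(P)}_p` as soon as one collection of positive weight fails its
room inequality; the always-`≤` half is abc-iut-c312-d1's `realPrimePacketWith_lnνLp_hull_orbitH_le_negLogThetaPerImageAt`) is NOT in this file.
HONEST SCOPE: unconditional; all factors tame; residue degree one + `e_i ≥ 2` off `S` only; OUR typings (THE equivariant lift, THE logarithm,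
factorwise action; F-B28-1 untouched); EVEN degree (identity side), WILD, `p = 2` outside; equal-AS-TYPED ≠ equal in print; nothing here asserts that
abc is proved or refuted; no side taken on [IUTchIII] Cor. 3.12 / [IUTchIV] Thm. 1.10, on (U) vs (P), or on any author.
[claim: Mochizuki2012, status: disputed]; [cite: Mochizuki2012, IUTchIII Thm. 3.11 (i) p. 154; Rmk. 3.9.5 (i) p. 127; Cor. 3.12 Step (x) p. 181, Step (xi)
p. 183; IUTchIV Prop. 1.1 p. 9, Prop. 1.2 (ii) pp. 10–11, Prop. 1.4 (i), (iii) pp. 13–14]; [cite: DupuyHilado2025, §3.4, §3.7, §4.9, §4.12].  typed ≠ proved.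
-/

set_option autoImplicit false

noncomputable section

open Metric Set Bornology Function Module
open scoped Pointwise TensorProduct NormedField

namespace Summit.ABC.IUTFork.Thm311.Real

open NumberField IsDedekindDomain Literature.NumberTheory.NumberFields Literature.IUT.LogVolume
open Literature.NumberTheory.GaloisRepresentations Literature.NumberTheory.GaloisRepresentations.Ultrametric
open Literature.AnabelianGeometry.AbsoluteAnabelian Literature.IUT.HodgeArakelov
open Literature.IUT.HodgeArakelov.AbsTopMonoids

variable {K : Type} [Field K] [NumberField K] (p : ℕ) [hp : Fact p.Prime]

section Packet

variable {I : Type} [Fintype I] [DecidableEq I] (w : I → HeightOneSpectrum (𝓞 K)) (hw : ∀ i, ((p : ℕ) : 𝓞 K) ∈ (w i).asIdeal)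

/-! ## §1 The log-volume gap of the failure branch -/

/-- **THE FAILURE SIDE OF THE ROOM DICHOTOMY, QUANTIFIED (UNCONDITIONAL).**  Genuine packet `⊗_{i∈I} K_{w_i}` of TAME factors (`e_i ≤ p − 2`) of ANY
residue degrees; `‖g‖ = p^{−v/E}`, `A = (v−1) div E + 1 − |I|`; `S ⊆ I` carries no bit hypothesis; off `S`: residue degree one, `e_i ≥ 2`, and no realised
strip automorphism moves `ℤ_p·p` modulo `p·log_p(𝒪^×)` (`hfix`); R25 (A) §2's room inequality FAILS: `¬ (((v−1) % E + 1)/E + Σ_{i ∈ univ ∖ S} 1/e_i ≤ 1)`.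
Then for EVERY `H ≤ Aut_{ℚ_p}(X)` acting factorwise through the realised strip groups, the `(R_I)^∼`-hull of the `H`-orbit of `ι_{i₀}(g)·(R_I)^∼` is
admissible, **`log μ̄(hull) ≤ log μ̄(packetHull(p^{A}·log_p(R_I^×))) − (Σ_j f(L_j)/D)·log p`**, and the container value is `−(A + Σ_i 1/e_i)·log p`
(R28 (λ2) §2 confinement + gen 19's `prodRadius_lt_container_of_not_room` + the classical polydisc volume gap BY NAME).
[claim: Mochizuki2012, status: disputed] [cite: Mochizuki2012, IUTchIII Thm. 3.11 (i) p. 154; Rmk. 3.9.5 (i) p. 127; Cor. 3.12 Step (x) p. 181, Step (xi) p. 183;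
IUTchIV Prop. 1.1 p. 9, Prop. 1.2 (ii) p. 10, Prop. 1.4 (iii) p. 13] [cite: DupuyHilado2025, §3.4, §4.9, §4.12] -/
theorem packetLogμ_packetHull_orbit_le_container_sub_of_not_room_mixed (hp2 : 2 < p)
    (he : ∀ i, absRamificationIdx p (RescaledCompletion K p (w i) (hw i)) ≤ p - 2)
    (i₀ : I) {g : RescaledCompletion K p (w i₀) (hw i₀)} {v : ℤ}
    (hv : ‖g‖ = (p : ℝ) ^ (-(v / (absRamificationIdx p (RescaledCompletion K p (w i₀) (hw i₀)) : ℝ))))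
    (S : Finset I)
    (he2 : ∀ i, i ∉ S → 2 ≤ absRamificationIdx p (RescaledCompletion K p (w i) (hw i)))
    (hf : ∀ i, i ∉ S → (w i).asIdeal.inertiaDeg ℤ = 1)
    (hfix : ∀ i, i ∉ S → ∀ ψ ∈ ind1StripOf (w i) (galoisLog (w i)),
      RescaledCompletion.of K p (w i) (hw i) (ψ (p : (w i).adicCompletion K)) - (p : RescaledCompletion K p (w i) (hw i)) ∈
        (p : ℚ_[p]) • logUnits (RescaledCompletion K p (w i) (hw i)))
    (hnotroom : ¬ ((((v - 1) % (absRamificationIdx p (RescaledCompletion K p (w i₀) (hw i₀)) : ℤ) + 1 : ℤ) : ℝ) /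
        (absRamificationIdx p (RescaledCompletion K p (w i₀) (hw i₀)) : ℝ) +
      ∑ i ∈ Finset.univ \ S, (1 : ℝ) / (absRamificationIdx p (RescaledCompletion K p (w i) (hw i)) : ℝ) ≤ 1))
    (H : Subgroup (PacketAlgebra p (fun i => RescaledCompletion K p (w i) (hw i)) ≃ₗ[ℚ_[p]]
      PacketAlgebra p (fun i => RescaledCompletion K p (w i) (hw i))))
    (hHfac : ∀ γ ∈ H, ∃ δ : Π i, AddAut ((w i).adicCompletion K),
      (∀ i, δ i ∈ AddSubgroup.closure (G := AddAut ((w i).adicCompletion K)) (ind1StripOf (w i) (galoisLog (w i)))) ∧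
      ∀ z : Π i, RescaledCompletion K p (w i) (hw i),
        γ (PiTensorProduct.tprod ℚ_[p] z) =
          PiTensorProduct.tprod ℚ_[p] (fun i => RescaledCompletion.of K p (w i) (hw i)
            (δ i ((RescaledCompletion.of K p (w i) (hw i)).symm (z i))))) :
    PacketAdm p (fun i => RescaledCompletion K p (w i) (hw i))
        (packetHull p (fun i => RescaledCompletion K p (w i) (hw i))
          (⋃ γ : H, (γ : PacketAlgebra p (fun i => RescaledCompletion K p (w i) (hw i)) ≃ₗ[ℚ_[p]]
              PacketAlgebra p (fun i => RescaledCompletion K p (w i) (hw i))) ''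
            (iota p (fun i => RescaledCompletion K p (w i) (hw i)) i₀ g •
              (normalizedPacket p (fun i => RescaledCompletion K p (w i) (hw i)) :
                Set (PacketAlgebra p (fun i => RescaledCompletion K p (w i) (hw i))))))) ∧
    packetLogμ p (fun i => RescaledCompletion K p (w i) (hw i))
        (packetHull p (fun i => RescaledCompletion K p (w i) (hw i))
          (⋃ γ : H, (γ : PacketAlgebra p (fun i => RescaledCompletion K p (w i) (hw i)) ≃ₗ[ℚ_[p]]
              PacketAlgebra p (fun i => RescaledCompletion K p (w i) (hw i))) ''
            (iota p (fun i => RescaledCompletion K p (w i) (hw i)) i₀ g •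
              (normalizedPacket p (fun i => RescaledCompletion K p (w i) (hw i)) :
                Set (PacketAlgebra p (fun i => RescaledCompletion K p (w i) (hw i))))))) ≤
      packetLogμ p (fun i => RescaledCompletion K p (w i) (hw i))
          (packetHull p (fun i => RescaledCompletion K p (w i) (hw i))
            (((p : ℚ_[p]) ^ ((v - 1) / (absRamificationIdx p (RescaledCompletion K p (w i₀) (hw i₀)) : ℤ) + 1 - Fintype.card I)) •
              (logPacket p (fun i => RescaledCompletion K p (w i) (hw i)) :
                Set (PacketAlgebra p (fun i => RescaledCompletion K p (w i) (hw i)))))) -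
        (∑ j, (residueDegree p (DFac p (fun i => RescaledCompletion K p (w i) (hw i)) j) : ℝ)) /
          packetDegree p (DFac p (fun i => RescaledCompletion K p (w i) (hw i))) * Real.log p ∧
    packetLogμ p (fun i => RescaledCompletion K p (w i) (hw i))
        (packetHull p (fun i => RescaledCompletion K p (w i) (hw i))
          (((p : ℚ_[p]) ^ ((v - 1) / (absRamificationIdx p (RescaledCompletion K p (w i₀) (hw i₀)) : ℤ) + 1 - Fintype.card I)) •
            (logPacket p (fun i => RescaledCompletion K p (w i) (hw i)) :
              Set (PacketAlgebra p (fun i => RescaledCompletion K p (w i) (hw i)))))) =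
      -((((v - 1) / (absRamificationIdx p (RescaledCompletion K p (w i₀) (hw i₀)) : ℤ) + 1 - Fintype.card I : ℤ) : ℝ) * Real.log p) +
        -(∑ i, 1 / (absRamificationIdx p (RescaledCompletion K p (w i) (hw i)) : ℝ)) * Real.log p := by
  haveI : Nonempty I := ⟨i₀⟩
  set k := fun i => RescaledCompletion K p (w i) (hw i) with hk
  have hP : p.Prime := Fact.out
  have hp0 : (0 : ℝ) < p := by exact_mod_cast hP.pos
  -- the Θ-region `M = ι_{i₀}(g)·(R_I)^∼` is admissible and lies in its `H`-orbit
  have hg0 : g ≠ 0 := by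
    rw [← norm_pos_iff, hv]
    positivity
  have hM : PacketAdm p k (iota p k i₀ g • (normalizedPacket p k : Set (PacketAlgebra p k))) :=
    packetAdm_iota_smul p k i₀ hg0 (packetAdm_normalizedPacket p k)
  have hMO : iota p k i₀ g • (normalizedPacket p k : Set (PacketAlgebra p k)) ⊆
      ⋃ γ : H, (γ : PacketAlgebra p k ≃ₗ[ℚ_[p]] PacketAlgebra p k) ''
        (iota p k i₀ g • (normalizedPacket p k : Set (PacketAlgebra p k))) := by
    intro x hx
    refine Set.mem_iUnion.mpr ⟨(1 : H), ?_⟩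
    rw [OneMemClass.coe_one, LinearEquiv.coe_one, Set.image_id]
    exact hx
  -- R28 (λ2) §2: the hull of the orbit is confined to the polydisc of radius `R′_S`; gen 19: `R′_S <` the container radius
  have hconf := packetHull_orbit_smul_normalizedPacket_subset_polydisc_of_fixesBaseLine_off_mixed p w hw hp2 he i₀ hv S he2 hf hfix H hHfac
  have hlt := prodRadius_lt_container_of_not_room p w hw i₀ v S hnotroom
  -- the classical polydisc volume gap, with `U` := the orbit itself (`U ⊆ hull U ⊆ polydisc`)
  obtain ⟨hadm, hle, _⟩ :=
    packetLogμ_packetHull_le_container_sub_of_subset_preimage_polydisc_of_lt_of_tame p k hp2 he _ hlt hM hMO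
      ((subset_packetHull p k _).trans hconf)
  exact ⟨hadm, hle, packetLogμ_packetHull_zpow_smul_logPacket_of_tame p k hp2 he _⟩

/-- **The set statement recovered with a strict inequality**: under the same hypotheses `log μ̄(hull(H-orbit)) < log μ̄(packetHull(p^{A}·log_p(R_I^×)))`
— the log-volume shadow of R28 (λ2) §3 `packetHull_orbit_ne_container_of_not_room_mixed`. [claim: Mochizuki2012, status: disputed]
[cite: Mochizuki2012, IUTchIII Thm. 3.11 (i) p. 154; Cor. 3.12 Step (x) p. 181; IUTchIV Prop. 1.4 (iii) p. 13] [cite: DupuyHilado2025, §4.9, §4.12] -/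
theorem packetLogμ_packetHull_orbit_lt_container_of_not_room_mixed (hp2 : 2 < p)
    (he : ∀ i, absRamificationIdx p (RescaledCompletion K p (w i) (hw i)) ≤ p - 2)
    (i₀ : I) {g : RescaledCompletion K p (w i₀) (hw i₀)} {v : ℤ}
    (hv : ‖g‖ = (p : ℝ) ^ (-(v / (absRamificationIdx p (RescaledCompletion K p (w i₀) (hw i₀)) : ℝ))))
    (S : Finset I)
    (he2 : ∀ i, i ∉ S → 2 ≤ absRamificationIdx p (RescaledCompletion K p (w i) (hw i)))
    (hf : ∀ i, i ∉ S → (w i).asIdeal.inertiaDeg ℤ = 1)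
    (hfix : ∀ i, i ∉ S → ∀ ψ ∈ ind1StripOf (w i) (galoisLog (w i)),
      RescaledCompletion.of K p (w i) (hw i) (ψ (p : (w i).adicCompletion K)) - (p : RescaledCompletion K p (w i) (hw i)) ∈
        (p : ℚ_[p]) • logUnits (RescaledCompletion K p (w i) (hw i)))
    (hnotroom : ¬ ((((v - 1) % (absRamificationIdx p (RescaledCompletion K p (w i₀) (hw i₀)) : ℤ) + 1 : ℤ) : ℝ) /
        (absRamificationIdx p (RescaledCompletion K p (w i₀) (hw i₀)) : ℝ) +
      ∑ i ∈ Finset.univ \ S, (1 : ℝ) / (absRamificationIdx p (RescaledCompletion K p (w i) (hw i)) : ℝ) ≤ 1))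
    (H : Subgroup (PacketAlgebra p (fun i => RescaledCompletion K p (w i) (hw i)) ≃ₗ[ℚ_[p]]
      PacketAlgebra p (fun i => RescaledCompletion K p (w i) (hw i))))
    (hHfac : ∀ γ ∈ H, ∃ δ : Π i, AddAut ((w i).adicCompletion K),
      (∀ i, δ i ∈ AddSubgroup.closure (G := AddAut ((w i).adicCompletion K)) (ind1StripOf (w i) (galoisLog (w i)))) ∧
      ∀ z : Π i, RescaledCompletion K p (w i) (hw i),
        γ (PiTensorProduct.tprod ℚ_[p] z) =
          PiTensorProduct.tprod ℚ_[p] (fun i => RescaledCompletion.of K p (w i) (hw i)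
            (δ i ((RescaledCompletion.of K p (w i) (hw i)).symm (z i))))) :
    packetLogμ p (fun i => RescaledCompletion K p (w i) (hw i))
        (packetHull p (fun i => RescaledCompletion K p (w i) (hw i))
          (⋃ γ : H, (γ : PacketAlgebra p (fun i => RescaledCompletion K p (w i) (hw i)) ≃ₗ[ℚ_[p]]
              PacketAlgebra p (fun i => RescaledCompletion K p (w i) (hw i))) ''
            (iota p (fun i => RescaledCompletion K p (w i) (hw i)) i₀ g •
              (normalizedPacket p (fun i => RescaledCompletion K p (w i) (hw i)) :
                Set (PacketAlgebra p (fun i => RescaledCompletion K p (w i) (hw i))))))) <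
      packetLogμ p (fun i => RescaledCompletion K p (w i) (hw i))
        (packetHull p (fun i => RescaledCompletion K p (w i) (hw i))
          (((p : ℚ_[p]) ^ ((v - 1) / (absRamificationIdx p (RescaledCompletion K p (w i₀) (hw i₀)) : ℤ) + 1 - Fintype.card I)) •
            (logPacket p (fun i => RescaledCompletion K p (w i) (hw i)) :
              Set (PacketAlgebra p (fun i => RescaledCompletion K p (w i) (hw i)))))) := by
  haveI : Nonempty I := ⟨i₀⟩
  obtain ⟨-, hle, -⟩ := packetLogμ_packetHull_orbit_le_container_sub_of_not_room_mixed p w hw hp2 he i₀ hv S he2 hf hfix hnotroom H hHfac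
  have hpos := margin_pos p (fun i => RescaledCompletion K p (w i) (hw i))
  linarith

/-! ## §2 The packet-intrinsic margin `(log p)/D` -/

/-- **Packet-intrinsic form of the gap**: under the hypotheses of §1, `log μ̄(hull(H-orbit)) ≤ log μ̄(packetHull(p^{A}·log_p(R_I^×))) − (log p)/D`
with `D = packetDegree = dim_{ℚ_p} X` (every Wedderburn factor has `f_j ≥ 1`; `log_div_degree_le_margin`). [claim: Mochizuki2012, status: disputed]
[cite: Mochizuki2012, IUTchIII Thm. 3.11 (i) p. 154; Cor. 3.12 Step (x) p. 181; IUTchIV Prop. 1.4 (i), (iii) p. 13] [cite: DupuyHilado2025, §3.4, §4.9, §4.12] -/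
theorem packetLogμ_packetHull_orbit_le_container_sub_log_div_degree_of_not_room_mixed (hp2 : 2 < p)
    (he : ∀ i, absRamificationIdx p (RescaledCompletion K p (w i) (hw i)) ≤ p - 2)
    (i₀ : I) {g : RescaledCompletion K p (w i₀) (hw i₀)} {v : ℤ}
    (hv : ‖g‖ = (p : ℝ) ^ (-(v / (absRamificationIdx p (RescaledCompletion K p (w i₀) (hw i₀)) : ℝ))))
    (S : Finset I)
    (he2 : ∀ i, i ∉ S → 2 ≤ absRamificationIdx p (RescaledCompletion K p (w i) (hw i)))
    (hf : ∀ i, i ∉ S → (w i).asIdeal.inertiaDeg ℤ = 1)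
    (hfix : ∀ i, i ∉ S → ∀ ψ ∈ ind1StripOf (w i) (galoisLog (w i)),
      RescaledCompletion.of K p (w i) (hw i) (ψ (p : (w i).adicCompletion K)) - (p : RescaledCompletion K p (w i) (hw i)) ∈
        (p : ℚ_[p]) • logUnits (RescaledCompletion K p (w i) (hw i)))
    (hnotroom : ¬ ((((v - 1) % (absRamificationIdx p (RescaledCompletion K p (w i₀) (hw i₀)) : ℤ) + 1 : ℤ) : ℝ) /
        (absRamificationIdx p (RescaledCompletion K p (w i₀) (hw i₀)) : ℝ) +
      ∑ i ∈ Finset.univ \ S, (1 : ℝ) / (absRamificationIdx p (RescaledCompletion K p (w i) (hw i)) : ℝ) ≤ 1))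
    (H : Subgroup (PacketAlgebra p (fun i => RescaledCompletion K p (w i) (hw i)) ≃ₗ[ℚ_[p]]
      PacketAlgebra p (fun i => RescaledCompletion K p (w i) (hw i))))
    (hHfac : ∀ γ ∈ H, ∃ δ : Π i, AddAut ((w i).adicCompletion K),
      (∀ i, δ i ∈ AddSubgroup.closure (G := AddAut ((w i).adicCompletion K)) (ind1StripOf (w i) (galoisLog (w i)))) ∧
      ∀ z : Π i, RescaledCompletion K p (w i) (hw i),
        γ (PiTensorProduct.tprod ℚ_[p] z) =
          PiTensorProduct.tprod ℚ_[p] (fun i => RescaledCompletion.of K p (w i) (hw i)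
            (δ i ((RescaledCompletion.of K p (w i) (hw i)).symm (z i))))) :
    packetLogμ p (fun i => RescaledCompletion K p (w i) (hw i))
        (packetHull p (fun i => RescaledCompletion K p (w i) (hw i))
          (⋃ γ : H, (γ : PacketAlgebra p (fun i => RescaledCompletion K p (w i) (hw i)) ≃ₗ[ℚ_[p]]
              PacketAlgebra p (fun i => RescaledCompletion K p (w i) (hw i))) ''
            (iota p (fun i => RescaledCompletion K p (w i) (hw i)) i₀ g •
              (normalizedPacket p (fun i => RescaledCompletion K p (w i) (hw i)) :
                Set (PacketAlgebra p (fun i => RescaledCompletion K p (w i) (hw i))))))) ≤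
      packetLogμ p (fun i => RescaledCompletion K p (w i) (hw i))
          (packetHull p (fun i => RescaledCompletion K p (w i) (hw i))
            (((p : ℚ_[p]) ^ ((v - 1) / (absRamificationIdx p (RescaledCompletion K p (w i₀) (hw i₀)) : ℤ) + 1 - Fintype.card I)) •
              (logPacket p (fun i => RescaledCompletion K p (w i) (hw i)) :
                Set (PacketAlgebra p (fun i => RescaledCompletion K p (w i) (hw i)))))) -
        Real.log p / packetDegree p (DFac p (fun i => RescaledCompletion K p (w i) (hw i))) := by
  haveI : Nonempty I := ⟨i₀⟩
  obtain ⟨-, hle, -⟩ := packetLogμ_packetHull_orbit_le_container_sub_of_not_room_mixed p w hw hp2 he i₀ hv S he2 hf hfix hnotroom H hHfac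
  have hmar := log_div_degree_le_margin p (fun i => RescaledCompletion K p (w i) (hw i))
  linarith

end Packet

end Summit.ABC.IUTFork.Thm311.Real

end
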